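import Summits.ResolutionOfSingularities.ResolutionOfSingularities.Theorems.WildQuotientsSummitReductionStubPairOrbitBlowupCentreNewModel
import Summits.ResolutionOfSingularities.ResolutionOfSingularities.Theorems.WildQuotientsSummitReductionStubPairOrbitBlowupCentreNewTransfer
import Summits.ResolutionOfSingularities.ResolutionOfSingularities.Theorems.WildQuotientsSummitReductionStubPairOrbitBlowupCentreNewResidue
import Summits.ResolutionOfSingularities.ResolutionOfSingularities.Theorems.WildQuotientsSummitReductionStubPairOrbitBlowupCentreNewBlowupModel
import Summits.ResolutionOfSingularities.ResolutionOfSingularities.Theorems.WildQuotientsSummitReductionStubPairOrbitBlowupCentreNewThickness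
import HarnessLib

/-!
# `WildQuotients.SummitReduction` (stmt-ResolutionOfSingularities-16324), line `FramePerfect`, skeleton v8:
# helper lemmas for stub `stub_pair_orbitBlowupCentreNew` (C3) — "Clearly, `n_T` has dropped by 2"
# along one orbit (de Jong 1996, 3.4, Claim (iii); de Jong 1997, proof of 5.11 ¶1), any field

Route `ResolutionOfSingularities/WildQuotients`, crux `SummitReduction`; worker file supporting the
registered stub `stub_pair_orbitBlowupCentreNew` of the line skeleton (v8, lead c4).

* `centreNew_fittingIdeal_kaehler_eq_of_surjective`, `centreNew_nodeThickness_comp_iso`,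
  `centreNew_nodeThickness_translate` — the thickness `n(x) = ℓ(𝒪_{X,x}/Fitt₁(Ω_{X/Y}))` is
  unchanged by an isomorphism of the base and is `G`-INVARIANT: `n(g x) = n(x)` for an equivariant
  `f` (`Ω_{B/A''} = Ω_{B/A}` when `A'' → A` is onto);
* `centreNew_isUnit_of_notMem_triplePrime` — for `m ≤ 1` the ideal `(u, v, T_{i₀})` of
  `K⟦u, v, T⟧/(uv - ∏ Tᵢ^{νᵢ})` is the maximal ideal;
* `centreNew_nodeThickness_drop` — **"Clearly, `n_T` has dropped by 2"** (de Jong 1996, p. 64) for the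
  blow-up of the orbit closure of a codimension-2 singular point `x` of a quasi-split `G`-strict
  `G`-semi-stable pair of the line: at a codimension-`≤ 2` singular point `x₁` of `X₁` over the
  translate `g x`, `n(x₁) + 2 = n(g x)` — the formal model at `g x` (`centreNew_exists_orbitModel`,
  `m = dim 𝒪_{Y,f(g x)} = 1`), the residue field of `x₁` (`centreNew_transfer_residue`), the model of
  the blow-up at `x₁` (`centreNew_exists_blowupModel`, chart "`t₁ ≠ 0`") and the thickness read off
  both models (`centreNew_nodeThickness_eq_of_model`).
-/

set_option linter.dupNamespace false

noncomputable section

open CategoryTheory CategoryTheory.Limits AlgebraicGeometry TopologicalSpace Topology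
open Literature.AlgebraicGeometry.Resolution
open Literature.AlgebraicGeometry
open IsLocalRing Scheme.IdealSheafData DeJong1996 DeJong1996.FormalNodeRing NodalDeformation
open Literature.RingTheory.FittingIdeal

namespace Summit.ResolutionOfSingularities.ResolutionOfSingularities.Theorems

universe u

/-! ## `Fitt₁(Ω)` only depends on the image of the base -/

/-- **`Ω_{B/A''} ≅ Ω_{B/A}` when `A'' → A → B` with `A'' → A` onto**: an `A''`-derivation of `B`
is automatically an `A`-derivation (the images of `A''` and `A` in `B` coincide), so the two
modules of Kähler differentials corepresent the same functor; hence their Fitting ideals agree.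
[folklore] -/
theorem centreNew_fittingIdeal_kaehler_eq_of_surjective {A'' A B : Type u} [CommRing A''] [CommRing A]
    [CommRing B] [Algebra A'' A] [Algebra A B] [Algebra A'' B] [IsScalarTower A'' A B]
    (hσ : Function.Surjective (algebraMap A'' A)) :
    Module.fittingIdeal B (Ω[B⁄A'']) 1 = Module.fittingIdeal B (Ω[B⁄A]) 1 := by
  -- `F : Ω_{B/A''} → Ω_{B/A}` and `G : Ω_{B/A} → Ω_{B/A''}`, both `B`-linear, from derivations
  let DF : Derivation A'' B (Ω[B⁄A]) := (KaehlerDifferential.D A B).restrictScalars A''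
  let F : Ω[B⁄A''] →ₗ[B] Ω[B⁄A] := DF.liftKaehlerDifferential
  have hkill : ∀ a : A, KaehlerDifferential.D A'' B (algebraMap A B a) = 0 := by
    intro a
    obtain ⟨a'', rfl⟩ := hσ a
    rw [← IsScalarTower.algebraMap_apply]
    exact Derivation.map_algebraMap _ a''
  let LG : B →ₗ[A] Ω[B⁄A''] :=
    { toFun := KaehlerDifferential.D A'' B
      map_add' := fun x y => map_add _ x y
      map_smul' := fun a b => by
        rw [Algebra.smul_def, Derivation.leibniz, hkill, smul_zero, add_zero, RingHom.id_apply]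
        exact algebraMap_smul B a _ }
  let DG : Derivation A B (Ω[B⁄A'']) :=
    { toLinearMap := LG
      map_one_eq_zero' := (KaehlerDifferential.D A'' B).map_one_eq_zero
      leibniz' := fun x y => (KaehlerDifferential.D A'' B).leibniz x y }
  let G : Ω[B⁄A] →ₗ[B] Ω[B⁄A''] := DG.liftKaehlerDifferential
  have hF : ∀ b, F (KaehlerDifferential.D A'' B b) = KaehlerDifferential.D A B b := fun b =>
    DF.liftKaehlerDifferential_comp_D b
  have hG : ∀ b, G (KaehlerDifferential.D A B b) = KaehlerDifferential.D A'' B b := fun b =>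
    DG.liftKaehlerDifferential_comp_D b
  have hGF : G.comp F = LinearMap.id := by
    refine Derivation.liftKaehlerDifferential_unique _ _ (Derivation.ext fun b => ?_)
    change G (F (KaehlerDifferential.D A'' B b)) = KaehlerDifferential.D A'' B b
    rw [hF, hG]
  have hFG : F.comp G = LinearMap.id := by
    refine Derivation.liftKaehlerDifferential_unique _ _ (Derivation.ext fun b => ?_)
    change F (G (KaehlerDifferential.D A B b)) = KaehlerDifferential.D A B b
    rw [hG, hF]
  let e : Ω[B⁄A''] ≃ₗ[B] Ω[B⁄A] := LinearEquiv.ofLinear F G hFG hGF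
  have he : ∀ (r : B) (ω : Ω[B⁄A'']), e.toAddEquiv (r • ω) = (RingEquiv.refl B) r • e.toAddEquiv ω :=
    fun r ω => e.map_smul r ω
  have h := fittingIdeal_map_ringEquiv (RingEquiv.refl B) e.toAddEquiv he 1
  rwa [show ((RingEquiv.refl B : B ≃+* B) : B →+* B) = RingHom.id B from rfl, Ideal.map_id] at h

/-! ## The thickness is unchanged by an isomorphism of the base; `G`-invariance -/

/-- **`n(f ≫ e, x) = n(f, x)` for an isomorphism `e` of the base**: the base local rings
`𝒪_{Y',e(f x)} ≅ 𝒪_{Y,f x}` have the same image in `𝒪_{X,x}`, so the modules of differentials and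
their Fitting ideals agree (`centreNew_fittingIdeal_kaehler_eq_of_surjective`). [folklore] -/
theorem centreNew_nodeThickness_comp_iso {X Y Y' : Scheme.{u}} (f : X ⟶ Y) (e : Y ⟶ Y') [IsIso e]
    (x : X) : Scheme.Hom.nodeThickness (f ≫ e) x = Scheme.Hom.nodeThickness f x := by
  let B : Type u := X.presheaf.stalk x
  let A : Type u := Y.presheaf.stalk (f.base x)
  let A'' : Type u := Y'.presheaf.stalk (e.base (f.base x))
  letI algAB : Algebra A B := (f.stalkMap x).hom.toAlgebra
  letI algA''B : Algebra A'' B := ((f ≫ e).stalkMap x).hom.toAlgebra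
  letI algA''A : Algebra A'' A := (e.stalkMap (f.base x)).hom.toAlgebra
  haveI : IsScalarTower A'' A B := IsScalarTower.of_algebraMap_eq fun a => by
    change ((f ≫ e).stalkMap x).hom a = (f.stalkMap x).hom ((e.stalkMap (f.base x)).hom a)
    rw [Scheme.Hom.stalkMap_comp]
    rfl
  have hσ : Function.Surjective (algebraMap A'' A) :=
    (ConcreteCategory.bijective_of_isIso (e.stalkMap (f.base x))).2
  change Module.length B (B ⧸ Module.fittingIdeal B (Ω[B⁄A'']) 1) =
    Module.length B (B ⧸ Module.fittingIdeal B (Ω[B⁄A]) 1)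
  rw [centreNew_fittingIdeal_kaehler_eq_of_surjective hσ]

/-- **`G`-invariance of the thickness**: for `f : X ⟶ Y` equivariant under actions of `G` on `X`
and `Y`, `n(g x) = n(x)` (`Scheme.Hom.nodeThickness_comp_eq_of_isIso_stalkMap` along `g : X ≅ X`,
then `centreNew_nodeThickness_comp_iso` along `g : Y ≅ Y`). [folklore] -/
theorem centreNew_nodeThickness_translate {X Y : Scheme.{u}} (f : X ⟶ Y) {G : Type*} [Group G]
    (ρX : G →* Aut X) (ρY : G →* Aut Y) (hρf : ∀ g : G, (ρX g).hom ≫ f = f ≫ (ρY g).hom)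
    (g : G) (x : X) :
    Scheme.Hom.nodeThickness f ((ρX g).hom.base x) = Scheme.Hom.nodeThickness f x := by
  rw [← Scheme.Hom.nodeThickness_comp_eq_of_isIso_stalkMap (ρX g).hom f x, hρf g]
  exact centreNew_nodeThickness_comp_iso f (ρY g).hom x

/-! ## For `m ≤ 1`, `(u, v, T_{i₀})` is the maximal ideal of the formal node ring -/

/-- For `m ≤ 1` (so `i₀` is the only index) and `ν_{i₀} ≠ 0`, every element of
`K⟦u, v, T⟧/(uv - ∏ Tᵢ^{νᵢ})` outside `(u, v, T_{i₀})` is a unit: the maximal ideal is generated by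
`u, v, T_{i₀}` (`FormalNodeRing.maximalIdeal_eq_span`). [folklore] -/
theorem centreNew_isUnit_of_notMem_triplePrime {K : Type u} [Field K] {m : ℕ} {ν : Fin m → ℕ}
    (i₀ : Fin m) (hm : m ≤ 1) (hν : ν i₀ ≠ 0) (s : FormalNodeRing K m ν)
    (hs : s ∉ triplePrime K m ν i₀) : IsUnit s := by
  haveI : Subsingleton (Fin m) := Fin.subsingleton_iff_le_one.mpr hm
  haveI := FormalNodeRing.isLocalRing K m ⟨i₀, hν⟩
  by_contra hu
  have hmem : s ∈ maximalIdeal (FormalNodeRing K m ν) := hu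
  rw [FormalNodeRing.maximalIdeal_eq_span K m ⟨i₀, hν⟩] at hmem
  refine hs ((Ideal.span_le.mpr ?_) hmem)
  rintro _ ⟨j, rfl⟩
  obtain ⟨h0, h1, h2⟩ := mk_X_mem_triplePrime K (ν := ν) i₀
  rcases j with j | j
  · fin_cases j
    · exact h0
    · exact h1
  · rw [Subsingleton.elim j i₀]
    exact h2

/-! ## "Clearly, `n_T` has dropped by 2" along one orbit -/

set_option maxHeartbeats 3200000 in
/-- **de Jong 1996, 3.4, Claim (iii): "Clearly, `n_T` has dropped by 2"**, for the blow-up of the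
orbit closure `cl(G · x)` of a codimension-2 singular point `x` of a quasi-split `G`-strict
`G`-semi-stable pair of the line, over an arbitrary field: at a codimension-`≤ 2` singular point `x₁`
of `X₁` over a translate `g x`, `n(x₁) + 2 = n(g x)`. Proof as printed, through the formal models:
at `z = g x` (`m = dim 𝒪_{Y,f z} = 1`) the model `𝒪̂_{X,z} ≅ Â⟦u, v⟧/(uv - t̂^{ν})` with completed centre
`(u, v, t̂)` (`centreNew_exists_orbitModel`), so `n(g x) = ν` (`centreNew_nodeThickness_eq_of_model`);
`x₁` is rational over `z` (`centreNew_transfer_residue`) with `dim 𝒪_{X₁,x₁} = 2` (`centreNew_transfer`),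
so `𝒪̂_{X₁,x₁} ≅ Â⟦u', v'⟧/(u'v' - t̂^{ν-2})` over `Â` (`centreNew_exists_blowupModel`, chart "`t₁ ≠ 0`")
and `n(x₁) = ν - 2`. [cite: DeJong1996, 3.4 Claim (iii), p. 64]
[cite: DeJong1997, proof of Prop. 5.11, p. 618] -/
theorem centreNew_nodeThickness_drop (k : Type) [Field k] (Y : Scheme.{0}) [IsIntegral Y]
    (q : Y ⟶ Spec (.of k)) (hreg : Scheme.IsRegular Y) (D : Set Y)
    (hD : IsStrictNormalCrossingsDivisor Y D) (G : Type) [Group G] [Finite G] (ρY : G →* Aut Y)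
    (hDG : (∀ g : G, (ρY g).hom.base '' D = D))
    (hDstrict : (∀ (g : G) (C : Set Y), Maximal (fun C : Set Y => IsIrreducible C ∧ C ⊆ D) C →
        (C ∩ (ρY g).hom.base '' C).Nonempty → (ρY g).hom.base '' C = C))
    (X : Scheme.{0}) [IsIntegral X] (f : X ⟶ Y) (ρX : G →* Aut X)
    (hprojX : Motives.IsProjectiveOver (Over.mk (f ≫ q)))
    (hρf : ∀ g : G, (ρX g).hom ≫ f = f ≫ (ρY g).hom) (hss : IsSemiStableCurve f)
    (hqs : (∀ x : X, (¬ ∃ U : X.Opens, x ∈ U ∧ Smooth (U.ι ≫ f)) →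
        ∃ e : AdicCompletion
            ((IsLocalRing.maximalIdeal (X.presheaf.stalk x)).map (Ideal.Quotient.mk
              ((IsLocalRing.maximalIdeal (Y.presheaf.stalk (f.base x))).map (f.stalkMap x).hom)))
            (X.presheaf.stalk x ⧸
              (IsLocalRing.maximalIdeal (Y.presheaf.stalk (f.base x))).map (f.stalkMap x).hom) ≃+*
          MvPowerSeries (Fin 2) (Y.presheaf.stalk (f.base x) ⧸ IsLocalRing.maximalIdeal (Y.presheaf.stalk (f.base x))) ⧸
            Ideal.span {(MvPowerSeries.X 0 * MvPowerSeries.X 1 :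
              MvPowerSeries (Fin 2) (Y.presheaf.stalk (f.base x) ⧸ IsLocalRing.maximalIdeal (Y.presheaf.stalk (f.base x))))},
          e.toRingHom.comp ((algebraMap (X.presheaf.stalk x ⧸
              (IsLocalRing.maximalIdeal (Y.presheaf.stalk (f.base x))).map (f.stalkMap x).hom) _).comp
            (Ideal.quotientMap ((IsLocalRing.maximalIdeal (Y.presheaf.stalk (f.base x))).map (f.stalkMap x).hom)
              (f.stalkMap x).hom Ideal.le_comap_map)) =
          algebraMap (Y.presheaf.stalk (f.base x) ⧸ IsLocalRing.maximalIdeal (Y.presheaf.stalk (f.base x))) _))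
    (hsm : Smooth (f ∣_ ⟨Dᶜ, hD.isClosed.isOpen_compl⟩))
    (x : X) (hx : x ∈ Scheme.singularLocusCodimLE X 2) (X₁ : Scheme.{0}) (π : X₁ ⟶ X)
    (hπ : IsBlowup π (Scheme.IdealSheafData.vanishingIdeal
      ⟨closure (Set.range fun g : G => (ρX g).hom.base x), isClosed_closure⟩))
    (x₁ : X₁) (hx₁ : x₁ ∈ Scheme.singularLocusCodimLE X₁ 2) (g : G)
    (hπx₁ : π.base x₁ = (ρX g).hom.base x) :
    Scheme.Hom.nodeThickness (π ≫ f) x₁ + 2 = Scheme.Hom.nodeThickness f ((ρX g).hom.base x) := by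
  classical
  haveI : IsNoetherian X := DeJong1996.isNoetherian_of_isProjectiveOver (f ≫ q) hprojX
  haveI : IsLocallyNoetherian Y := isLocallyNoetherian_base hss
  haveI : Flat f := hss.flat
  haveI := hss.locallyOfFiniteType
  haveI : IsProper (f ≫ q) := Motives.IsProjectiveOver.isProper (X := Over.mk (f ≫ q)) hprojX
  haveI : IsProper π := hπ.isProper
  haveI : IsLocallyNoetherian X₁ := LocallyOfFiniteType.isLocallyNoetherian π
  -- the centre and the translate `z = π x₁ = g x`
  set Z : Set X := closure (Set.range fun g : G => (ρX g).hom.base x) with hZdef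
  have hZ : IsClosed Z := isClosed_closure
  have hxg : (ρX g).hom.base x ∈ Scheme.singularLocusCodimLE X 2 := mem_singularLocusCodimLE_of_iso (ρX g) hx
  have hzs : π.base x₁ ∈ Scheme.singularLocusCodimLE X 2 := by rw [hπx₁]; exact hxg
  have hg₀ : (ρX g).hom.base x ⤳ π.base x₁ := by rw [hπx₁]
  have hzZ : π.base x₁ ∈ Z := by rw [hπx₁]; exact subset_closure ⟨g, rfl⟩
  haveI : LocallyOfFiniteType (f ≫ q) := inferInstance
  haveI : IsIntegral X₁ := hπ.isIntegral (vanishingIdeal_ne_bot_of_not_isRegularLocalRing (X := X) hZ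
    (fun y hy => closure_subset_not_isRegularLocalRing f q (S := Set.range fun g : G => (ρX g).hom.base x)
      (by rintro _ ⟨g', rfl⟩; exact (mem_singularLocusCodimLE_of_iso (ρX g') hx).1) hy))
  -- `z` is a non-smooth point; the quasi-split residue statement at `z`
  have hns : ¬ ∃ U : X.Opens, π.base x₁ ∈ U ∧ Smooth (U.ι ≫ f) := fun ⟨U, hzU, hU⟩ =>
    hzs.1 (isRegularLocalRing_of_smooth_of_isRegular hreg f hU hzU)
  have hresz : ∀ b : X.presheaf.stalk (π.base x₁), ∃ a : Y.presheaf.stalk (f.base (π.base x₁)),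
      b - (f.stalkMap (π.base x₁)).hom a ∈ maximalIdeal _ := by
    obtain ⟨e, he⟩ := hqs (π.base x₁) hns
    exact exists_sub_mem_maximalIdeal_of_quasiSplit (f.stalkMap (π.base x₁)).hom e he
  -- ### the formal model at `z` with its completed centre
  obtain ⟨m, w, ν, i₀, ι, e₁, E, hw, hm, hι, he₁, hEX, hEC, hi₀, -, -, hJ, hJ₀⟩ :=
    centreNew_exists_orbitModel k Y q hreg D hD G ρY hDG hDstrict X f ρX hprojX hρf hss hqs hsm x hx hg₀
  let A : Type := Y.presheaf.stalk (f.base (π.base x₁))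
  let O : Type := X.presheaf.stalk (π.base x₁)
  let K : Type := ResidueField A
  -- `m = 1`
  have hdimA : ringKrullDim A ≤ 1 :=
    ringKrullDim_base_le_one_of_codimLE f (hss.isReduced_fiber _) (hreg _) hzs
  have hm1 : m ≤ 1 := by
    rw [hm] at hdimA
    exact_mod_cast hdimA
  haveI : Subsingleton (Fin m) := Fin.subsingleton_iff_le_one.mpr hm1
  have hm1' : m = 1 := le_antisymm hm1 (Nat.one_le_iff_ne_zero.mpr fun h0 => by
    subst h0; exact Fin.elim0 i₀)
  -- ### the transfer at `z`: dimension and residue field of `x₁`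
  set eM := e₁.trans E with heM
  have hsp₁ : π.base x₁ ⤳ π.base x₁ := le_rfl
  obtain ⟨hover, -⟩ := centreNew_transfer hZ hπ hg₀ hi₀ eM hJ hJ₀
  obtain ⟨-, hdim2⟩ := hover x₁ hx₁ hzZ hsp₁
  have hmax := centreNew_isUnit_of_notMem_triplePrime (K := K) (ν := ν) i₀ hm1 (by omega)
  have hres₀ := centreNew_transfer_residue hZ hπ hg₀ hi₀ eM hJ hJ₀ hmax x₁ hx₁ hzZ hsp₁
  have hres₁ : ∀ r : X₁.presheaf.stalk x₁, ∃ a : A,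
      r - ((π ≫ f).stalkMap x₁).hom a ∈ maximalIdeal (X₁.presheaf.stalk x₁) := by
    intro r
    obtain ⟨o, ho⟩ := hres₀ r
    obtain ⟨a, ha⟩ := hresz o
    refine ⟨a, ?_⟩
    have h1 : (X.presheaf.stalkSpecializes hsp₁).hom o = o := by
      rw [TopCat.Presheaf.stalkSpecializes_refl]
      rfl
    rw [h1] at ho
    have h2 : ((π ≫ f).stalkMap x₁).hom a = (π.stalkMap x₁).hom ((f.stalkMap (π.base x₁)).hom a) := by
      rw [Scheme.Hom.stalkMap_comp]
      rfl
    have h3 : (π.stalkMap x₁).hom (o - (f.stalkMap (π.base x₁)).hom a) ∈ maximalIdeal _ :=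
      map_nonunit (π.stalkMap x₁).hom _ ha
    have := Ideal.add_mem _ ho h3
    rwa [map_sub, sub_add_sub_cancel, ← h2] at this
  -- ### inputs of the blow-up model in the `AdicCompletion.of` format
  have hofA : ∀ a : A, algebraMap A (Cpl A) a = AdicCompletion.of (maximalIdeal A) A a := fun a => rfl
  have hwm : ∀ i, w i ∈ maximalIdeal A := fun i => hw ▸ Ideal.subset_span ⟨i, rfl⟩
  have hι' : ∀ i, ι (AdicCompletion.of (maximalIdeal A) A (w i)) = MvPowerSeries.X i := fun i => hι i
  have he₁of : ∀ a : A, e₁ (algebraMap O (Cpl O) ((f.stalkMap (π.base x₁)).hom a)) =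
      NodeDeformationRing.ofBase _ _ (AdicCompletion.of (maximalIdeal A) A a) := by
    intro a
    have h1 : algebraMap O (Cpl O) ((f.stalkMap (π.base x₁)).hom a) =
        completedStalkMap f (π.base x₁) (algebraMap A (Cpl A) a) := by
      rw [AdicCompletion.algebraMap_apply, Algebra.algebraMap_self_apply, hofA, completedStalkMap_of]
    rw [h1]
    exact he₁ _
  -- the completed centre in the `Â`-model: `(u, v, ŵ_{i₀})`
  have hS3 : (Ideal.span ({Ideal.Quotient.mk _ (MvPowerSeries.X 0), Ideal.Quotient.mk _ (MvPowerSeries.X 1),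
      NodeDeformationRing.ofBase _ _ (algebraMap A (Cpl A) (w i₀))} :
        Set (NodeDeformationRing (Cpl A) (∏ i, algebraMap A (Cpl A) (w i) ^ ν i)))).map
        E.toRingHom = triplePrime K m ν i₀ := by
    obtain ⟨h0, h1, h2⟩ := mk_X_mem_triplePrime K (ν := ν) i₀
    have hEw : E (NodeDeformationRing.ofBase _ _ (algebraMap A (Cpl A) (w i₀))) =
        Ideal.Quotient.mk _ (MvPowerSeries.X (Sum.inr i₀)) := by
      rw [hEC, hι i₀, MvPowerSeriesNested.inrHom_X]
    apply le_antisymm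
    · rw [Ideal.map_span, Ideal.span_le]
      rintro _ ⟨s, hs, rfl⟩
      simp only [Set.mem_insert_iff, Set.mem_singleton_iff] at hs
      rcases hs with rfl | rfl | rfl
      · change E _ ∈ _; rw [hEX 0]; exact h0
      · change E _ ∈ _; rw [hEX 1]; exact h1
      · change E _ ∈ _; rw [hEw]; exact h2
    · rw [← TripleCentre.map_span_range_centreSeq K m ν i₀, Ideal.map_span, Ideal.span_le]
      rintro _ ⟨_, ⟨j, rfl⟩, rfl⟩
      refine Ideal.subset_span ?_
      fin_cases j
      · exact ⟨_, Ideal.subset_span (Set.mem_insert _ _), hEX 0⟩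
      · exact ⟨_, Ideal.subset_span (Set.mem_insert_of_mem _ (Set.mem_insert _ _)), hEX 1⟩
      · exact ⟨_, Ideal.subset_span (Set.mem_insert_of_mem _ (Set.mem_insert_of_mem _ (Set.mem_singleton _))), hEw⟩
  have hΛcentre : ((primeOfSpecializes hg₀).map (algebraMap O (Cpl O))).map e₁.toRingHom =
      Ideal.span ({Ideal.Quotient.mk _ (MvPowerSeries.X 0), Ideal.Quotient.mk _ (MvPowerSeries.X 1),
        NodeDeformationRing.ofBase _ _ (algebraMap A (Cpl A) (w i₀))} :
        Set (NodeDeformationRing (Cpl A) (∏ i, algebraMap A (Cpl A) (w i) ^ ν i))) := by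
    have h1 : (((primeOfSpecializes hg₀).map (algebraMap O (Cpl O))).map e₁.toRingHom).map E.toRingHom =
        triplePrime K m ν i₀ := by
      rw [Ideal.map_map, ← RingEquiv.toRingHom_trans, ← heM]
      exact hJ₀
    rw [← hS3] at h1
    have h2 := congrArg (Ideal.comap E.toRingHom) h1
    rwa [Ideal.comap_map_of_bijective E.toRingHom E.bijective,
      Ideal.comap_map_of_bijective E.toRingHom E.bijective] at h2
  -- ### the model of `X₁` at `x₁`
  have H4 : ringKrullDim (Cpl (X₁.presheaf.stalk x₁)) = (m + 1 : ℕ) := by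
    change ringKrullDim (AdicCompletion (maximalIdeal (X₁.presheaf.stalk x₁)) (X₁.presheaf.stalk x₁)) = _
    rw [ringKrullDim_adicCompletion, hm1']
    exact le_antisymm hx₁.2 hdim2
  obtain ⟨Ψ, hΨof⟩ := centreNew_exists_blowupModel f _ hπ hJ w ν i₀ hi₀ hwm ι hι' e₁ he₁of hΛcentre
    hx₁.1 hres₁ H4
  -- ### the thicknesses read off the two models
  haveI : LocallyOfFiniteType (π ≫ f ≫ q) := inferInstance
  have hG₁ : IsGRing (X₁.presheaf.stalk x₁) :=
    isGRing_stalk_of_polynomial Matsumura1987_32_polynomial_holds (π ≫ f ≫ q) x₁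
  have hG₀ : IsGRing O := isGRing_stalk_of_polynomial Matsumura1987_32_polynomial_holds (f ≫ q) (π.base x₁)
  -- exponents after the blow-up
  set th : Fin m → Cpl A := fun i => AdicCompletion.of (maximalIdeal A) A (w i) with hthdef
  set ν' : Fin m → ℕ := Function.update ν i₀ (ν i₀ - 2) with hν'def
  have hprod' : th i₀ ^ (ν i₀ - 2) * ∏ i ∈ Finset.univ.erase i₀, th i ^ ν i = ∏ i, th i ^ ν' i := by
    rw [← Finset.mul_prod_erase Finset.univ (fun i => th i ^ ν' i) (Finset.mem_univ i₀), hν'def,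
      Function.update_self]
    congr 1
    exact Finset.prod_congr rfl fun i hi => by rw [Function.update_of_ne (Finset.ne_of_mem_erase hi)]
  set Ψ' := Ψ.trans (NodeDeformationRing.congr (RingEquiv.refl _) _ _ hprod') with hΨ'def
  have hΨ'of : ∀ a : A, Ψ' (AdicCompletion.of (maximalIdeal (X₁.presheaf.stalk x₁)) _
      (((π ≫ f).stalkMap x₁).hom a)) = NodeDeformationRing.ofBase _ _ (AdicCompletion.of (maximalIdeal A) A a) := by
    intro a
    rw [hΨ'def, RingEquiv.trans_apply, hΨof a, NodeDeformationRing.ofBase_apply, NodeDeformationRing.congr_mk_C]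
    rfl
  haveI : LocallyOfFiniteType (π ≫ f) := inferInstance
  obtain ⟨i₁, hi₁, -, hthick₁⟩ := centreNew_nodeThickness_eq_of_model (π ≫ f) (specializes_refl x₁) hx₁ hG₁
    w ν' ι hι' Ψ' hΨ'of hres₁
  obtain ⟨i₂, -, -, hthick₂⟩ := centreNew_nodeThickness_eq_of_model f (specializes_refl (π.base x₁)) hzs hG₀
    w ν ι hι' e₁ he₁of hresz
  rw [Subsingleton.elim i₁ i₀] at hthick₁ hi₁
  rw [Subsingleton.elim i₂ i₀] at hthick₂
  rw [← hπx₁, hthick₁, hthick₂, hν'def, Function.update_self]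
  exact_mod_cast Nat.sub_add_cancel hi₀

end Summit.ResolutionOfSingularities.ResolutionOfSingularities.Theorems

end
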